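import Mathlib

/-!
# The even–odd effect of the two-mode Bose–Hubbard dimer at `U = 2J` (solo-blind, session 55; kernel K24)

Context (CLAIMS C190–C194, `work/mono_nu/DOUBLEWELL_s55.md`): the vertex-transitive double wells
`K_m × K_2` (and the bipartite `K_{m,m} × K_2`) refute the graph-general form of Conjecture M′
(monotonicity of the condensate fraction `N₀(n)/n` in the particle number, concavity of `N₀`),
and for fixed particle number `n` their `m → ∞` limit is the two-mode Bose–Hubbard dimer
`H = −J(a_t⁺ a_b + a_b⁺ a_t) + (U/2) Σ_w n_w (n_w − 1)` with `U/J = 2` (resp. `1`).  This file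
certifies, by exact real algebra, the dimer facts used there for `U = 2`, `J = 1`:

* `n = 2` (basis `|2,0⟩, |1,1⟩, |0,2⟩`): the quadratic form of `H` is
  `q₂(w) = 2w₀² + 2w₂² − 2√2·w₁(w₀ + w₂)`; the vector `ψ₂ = (√2, 1+√5, √2)` is an entrywise positive
  eigenvector with eigenvalue `E₂ = 1 − √5`, and `E₂` is the bottom of the spectrum
  (`E₂‖w‖² ≤ q₂(w)` for all `w`, by an explicit sum of squares); its bonding-mode occupation
  `n_+ = n/2 + ⟨a_t⁺a_b⟩ = 1 + (√2ψ₁ψ₀ + √2ψ₂ψ₁)/‖ψ‖²` equals `1 + 2√5/5 = 1 + 2/√5`.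
* `n = 3` (basis `|3,0⟩, …, |0,3⟩`): `q₃(w) = 6w₀² + 2w₁² + 2w₂² + 6w₃² − 2√3(w₀w₁ + w₂w₃) − 4w₁w₂`,
  ground vector `ψ₃ = (1, 2+√3, 2+√3, 1)`, eigenvalue `E₃ = 3 − 2√3`, bottom of the spectrum by an
  explicit sum of squares, bonding occupation `n_+(3) = 2 + √3/2`.
* Consequences: `n_+(3)/3 > n_+(2)/2` — the condensate FRACTION increases from `n = 2` to `n = 3`,
  i.e. (Mono-ν) fails in the dimer — and `n_+(3) + n_+(1) − 2 n_+(2) > 0` with `n_+(1) = 1`, i.e.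
  `n ↦ n_+(n)` is not concave at `n = 2` ((Conc-N₀) fails).

Only the finite-dimensional algebra is formalised; the identification of the dimer with the
`m → ∞` limit of the graphs (first-order degenerate perturbation theory) and the finite-`m`
numerics (kit job j182069) are not.  Self-contained; standard axioms only.
-/

namespace Summit.AtomisticToContinuum.BoseEinsteinCondensation.Theorems

open Real

/-- Bonding-mode occupation `n/2 + ⟨a_t⁺ a_b⟩` of a real state `ψ` of the two-particle dimer
(basis `|2,0⟩,|1,1⟩,|0,2⟩`; hopping matrix elements `√2`). -/
noncomputable def dimerBondOcc2 (ψ0 ψ1 ψ2 : ℝ) : ℝ :=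
  1 + (Real.sqrt 2 * ψ1 * ψ0 + Real.sqrt 2 * ψ2 * ψ1) / (ψ0 ^ 2 + ψ1 ^ 2 + ψ2 ^ 2)

/-- Bonding-mode occupation of a real state of the three-particle dimer
(basis `|3,0⟩,|2,1⟩,|1,2⟩,|0,3⟩`; hopping matrix elements `√3, 2, √3`). -/
noncomputable def dimerBondOcc3 (ψ0 ψ1 ψ2 ψ3 : ℝ) : ℝ :=
  3 / 2 + (Real.sqrt 3 * ψ1 * ψ0 + 2 * ψ2 * ψ1 + Real.sqrt 3 * ψ3 * ψ2) /
    (ψ0 ^ 2 + ψ1 ^ 2 + ψ2 ^ 2 + ψ3 ^ 2)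

/-- `(√5)² = 5`. -/
private lemma sq5 : Real.sqrt 5 ^ 2 = 5 := Real.sq_sqrt (by norm_num)
/-- `(√2)² = 2`. -/
private lemma sq2 : Real.sqrt 2 ^ 2 = 2 := Real.sq_sqrt (by norm_num)
/-- `(√3)² = 3`. -/
private lemma sq3 : Real.sqrt 3 ^ 2 = 3 := Real.sq_sqrt (by norm_num)

/-! ### `n = 2`, `U = 2J` -/

/-- `ψ₂ = (√2, 1+√5, √2)` solves `H₂ ψ = (1 − √5) ψ` for
`H₂ = [[2, −√2, 0], [−√2, 0, −√2], [0, −√2, 2]]` (the three rows). -/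
theorem dimer2_eigen :
    2 * Real.sqrt 2 - Real.sqrt 2 * (1 + Real.sqrt 5) = (1 - Real.sqrt 5) * Real.sqrt 2 ∧
    -Real.sqrt 2 * Real.sqrt 2 - Real.sqrt 2 * Real.sqrt 2 = (1 - Real.sqrt 5) * (1 + Real.sqrt 5) ∧
    -Real.sqrt 2 * (1 + Real.sqrt 5) + 2 * Real.sqrt 2 = (1 - Real.sqrt 5) * Real.sqrt 2 := by
  refine ⟨by ring, ?_, by ring⟩
  linear_combination sq5 - 2 * sq2

/-- The eigenvector `ψ₂` is entrywise positive (Perron–Frobenius ground state). -/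
theorem dimer2_pos : 0 < Real.sqrt 2 ∧ 0 < 1 + Real.sqrt 5 := by
  constructor
  · exact Real.sqrt_pos.mpr (by norm_num)
  · have := Real.sqrt_nonneg 5; linarith

/-- `E₂ = 1 − √5` is the bottom of the spectrum of `H₂`: `E₂‖w‖² ≤ ⟨w, H₂ w⟩` for every `w`
(explicit sum of two squares). -/
theorem dimer2_ground (w0 w1 w2 : ℝ) :
    (1 - Real.sqrt 5) * (w0 ^ 2 + w1 ^ 2 + w2 ^ 2) ≤
      2 * w0 ^ 2 + 2 * w2 ^ 2 - 2 * Real.sqrt 2 * w1 * (w0 + w2) := by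
  set a := Real.sqrt 5 with ha_def
  set b := Real.sqrt 2 with hb_def
  have ha : a ^ 2 = 5 := sq5
  have hb : b ^ 2 = 2 := sq2
  have key : 2 * w0 ^ 2 + 2 * w2 ^ 2 - 2 * b * w1 * (w0 + w2) - (1 - a) * (w0 ^ 2 + w1 ^ 2 + w2 ^ 2)
      = (a - 1) * (w1 - b * (w0 + w2) * (a + 1) / 4) ^ 2 + (1 + a) * (w0 - w2) ^ 2 / 2 := by
    linear_combination ((1/2) * b * w1 * w2 + (1/2) * b * w0 * w1 + (-1/16) * b ^ 2 * w2 ^ 2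
      + (-1/8) * b ^ 2 * w0 * w2 + (-1/16) * b ^ 2 * w0 ^ 2 + (-1/16) * a * b ^ 2 * w2 ^ 2
      + (-1/8) * a * b ^ 2 * w0 * w2 + (-1/16) * a * b ^ 2 * w0 ^ 2) * ha
      + ((-1/4) * w2 ^ 2 + (-1/2) * w0 * w2 + (-1/4) * w0 ^ 2 + (-1/4) * a * w2 ^ 2
      + (-1/2) * a * w0 * w2 + (-1/4) * a * w0 ^ 2) * hb
  have ha1 : 1 ≤ a := by
    rw [ha_def]; exact Real.one_le_sqrt.mpr (by norm_num)
  have h1 : 0 ≤ (a - 1) * (w1 - b * (w0 + w2) * (a + 1) / 4) ^ 2 :=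
    mul_nonneg (by linarith) (sq_nonneg _)
  have h2 : 0 ≤ (1 + a) * (w0 - w2) ^ 2 / 2 := by
    have := mul_nonneg (by linarith : (0:ℝ) ≤ 1 + a) (sq_nonneg (w0 - w2)); linarith
  linarith [key, h1, h2]

/-- Bonding occupation of the two-particle ground state: `n_+(2) = 1 + 2√5/5 (= 1 + 2/√5)`. -/
theorem dimer2_bondOcc :
    dimerBondOcc2 (Real.sqrt 2) (1 + Real.sqrt 5) (Real.sqrt 2) = 1 + 2 * Real.sqrt 5 / 5 := by
  unfold dimerBondOcc2
  set a := Real.sqrt 5 with ha_def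
  set b := Real.sqrt 2 with hb_def
  have ha : a ^ 2 = 5 := sq5
  have hb : b ^ 2 = 2 := sq2
  have hcoh : b * (1 + a) * b + b * b * (1 + a) = 4 + 4 * a := by
    linear_combination (2 + 2 * a) * hb
  have hnrm : b ^ 2 + (1 + a) ^ 2 + b ^ 2 = 10 + 2 * a := by
    linear_combination 2 * hb + ha
  have ha0 : 0 ≤ a := Real.sqrt_nonneg 5
  have hpos : (10 + 2 * a) ≠ 0 := by positivity
  rw [hcoh, hnrm]
  have : (4 + 4 * a) / (10 + 2 * a) = 2 * a / 5 := by
    rw [div_eq_div_iff hpos (by norm_num)]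
    linear_combination (-4) * ha
  rw [this]

/-! ### `n = 3`, `U = 2J` -/

/-- `ψ₃ = (1, 2+√3, 2+√3, 1)` solves `H₃ ψ = (3 − 2√3) ψ` for
`H₃ = [[6,−√3,0,0],[−√3,2,−2,0],[0,−2,2,−√3],[0,0,−√3,6]]` (the four rows). -/
theorem dimer3_eigen :
    6 * 1 - Real.sqrt 3 * (2 + Real.sqrt 3) = (3 - 2 * Real.sqrt 3) * 1 ∧
    -Real.sqrt 3 * 1 + 2 * (2 + Real.sqrt 3) - 2 * (2 + Real.sqrt 3) = (3 - 2 * Real.sqrt 3) * (2 + Real.sqrt 3) ∧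
    -2 * (2 + Real.sqrt 3) + 2 * (2 + Real.sqrt 3) - Real.sqrt 3 * 1 = (3 - 2 * Real.sqrt 3) * (2 + Real.sqrt 3) ∧
    -Real.sqrt 3 * (2 + Real.sqrt 3) + 6 * 1 = (3 - 2 * Real.sqrt 3) * 1 := by
  refine ⟨?_, ?_, ?_, ?_⟩
  · linear_combination (-1) * sq3
  · linear_combination 2 * sq3
  · linear_combination 2 * sq3
  · linear_combination (-1) * sq3

/-- The eigenvector `ψ₃` is entrywise positive. -/
theorem dimer3_pos : (0 : ℝ) < 1 ∧ 0 < 2 + Real.sqrt 3 := by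
  refine ⟨by norm_num, ?_⟩
  have := Real.sqrt_nonneg 3; linarith

/-- `E₃ = 3 − 2√3` is the bottom of the spectrum of `H₃` (explicit sum of three squares, one per
excited eigenvector). -/
theorem dimer3_ground (w0 w1 w2 w3 : ℝ) :
    (3 - 2 * Real.sqrt 3) * (w0 ^ 2 + w1 ^ 2 + w2 ^ 2 + w3 ^ 2) ≤
      6 * w0 ^ 2 + 2 * w1 ^ 2 + 2 * w2 ^ 2 + 6 * w3 ^ 2
        - 2 * Real.sqrt 3 * (w0 * w1 + w2 * w3) - 4 * w1 * w2 := by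
  set a := Real.sqrt 3 with ha_def
  have ha : a ^ 2 = 3 := sq3
  have key : 6 * w0 ^ 2 + 2 * w1 ^ 2 + 2 * w2 ^ 2 + 6 * w3 ^ 2
        - 2 * a * (w0 * w1 + w2 * w3) - 4 * w1 * w2 - (3 - 2 * a) * (w0 ^ 2 + w1 ^ 2 + w2 ^ 2 + w3 ^ 2)
      = (3 + 2 * a) / 2 * (w0 + w3 + (a - 2) * (w1 + w2)) ^ 2
        + a / 4 * (w0 - w3 + a * (w1 - w2)) ^ 2
        + (2 + a) / 4 * (a * (w0 - w3) - (w1 - w2)) ^ 2 := by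
    linear_combination ((-1/2) * w3 ^ 2 + (-2) * w2 * w3 + (5/2) * w2 ^ 2 + (-2) * w1 * w3
      + 5 * w1 * w2 + (5/2) * w1 ^ 2 + w0 * w3 + (-2) * w0 * w2 + (-2) * w0 * w1
      + (-1/2) * w0 ^ 2 + (-1/4) * a * w3 ^ 2 + (-5/4) * a * w2 ^ 2 + (-3/2) * a * w1 * w2
      + (-5/4) * a * w1 ^ 2 + (1/2) * a * w0 * w3 + (-1/4) * a * w0 ^ 2) * ha
  have ha0 : 0 ≤ a := Real.sqrt_nonneg 3
  have h1 : 0 ≤ (3 + 2 * a) / 2 * (w0 + w3 + (a - 2) * (w1 + w2)) ^ 2 :=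
    mul_nonneg (by positivity) (sq_nonneg _)
  have h2 : 0 ≤ a / 4 * (w0 - w3 + a * (w1 - w2)) ^ 2 := mul_nonneg (by positivity) (sq_nonneg _)
  have h3 : 0 ≤ (2 + a) / 4 * (a * (w0 - w3) - (w1 - w2)) ^ 2 :=
    mul_nonneg (by positivity) (sq_nonneg _)
  linarith [key, h1, h2, h3]

/-- Bonding occupation of the three-particle ground state: `n_+(3) = 2 + √3/2`. -/
theorem dimer3_bondOcc :
    dimerBondOcc3 1 (2 + Real.sqrt 3) (2 + Real.sqrt 3) 1 = 2 + Real.sqrt 3 / 2 := by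
  unfold dimerBondOcc3
  set a := Real.sqrt 3 with ha_def
  have ha : a ^ 2 = 3 := sq3
  have hcoh : a * (2 + a) * 1 + 2 * (2 + a) * (2 + a) + a * 1 * (2 + a) = 20 + 12 * a := by
    linear_combination 4 * ha
  have hnrm : (1:ℝ) ^ 2 + (2 + a) ^ 2 + (2 + a) ^ 2 + 1 ^ 2 = 16 + 8 * a := by
    linear_combination 2 * ha
  have ha0 : 0 ≤ a := Real.sqrt_nonneg 3
  have hpos : (16 + 8 * a) ≠ 0 := by positivity
  rw [hcoh, hnrm]
  have : (20 + 12 * a) / (16 + 8 * a) = (1 + a) / 2 := by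
    rw [div_eq_div_iff hpos (by norm_num)]
    linear_combination (-8) * ha
  rw [this]; ring

/-! ### The even–odd effect -/

/-- Rational lower bound `1.73 < √3`. -/
private lemma sqrt3_gt : (173 : ℝ) / 100 < Real.sqrt 3 := by
  rw [show (173:ℝ)/100 = Real.sqrt ((173/100) ^ 2) by rw [Real.sqrt_sq (by norm_num)]]
  exact Real.sqrt_lt_sqrt (by norm_num) (by norm_num)

/-- Rational upper bound `√5 < 2.237`. -/
private lemma sqrt5_lt : Real.sqrt 5 < (2237 : ℝ) / 1000 := by
  rw [show (2237:ℝ)/1000 = Real.sqrt ((2237/1000) ^ 2) by rw [Real.sqrt_sq (by norm_num)]]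
  exact Real.sqrt_lt_sqrt (by norm_num) (by norm_num)

/-- (Mono-ν) fails in the `U = 2J` dimer: the condensate fraction rises from `n = 2` to `n = 3`,
`n_+(2)/2 < n_+(3)/3` (numerically `0.9472 < 0.9553`). -/
theorem dimer_evenodd_fraction :
    dimerBondOcc2 (Real.sqrt 2) (1 + Real.sqrt 5) (Real.sqrt 2) / 2 <
      dimerBondOcc3 1 (2 + Real.sqrt 3) (2 + Real.sqrt 3) 1 / 3 := by
  rw [dimer2_bondOcc, dimer3_bondOcc]
  have h3 := sqrt3_gt
  have h5 := sqrt5_lt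
  linarith

/-- (Conc-N₀) fails in the `U = 2J` dimer: with `n_+(1) = 1`,
`n_+(3) + n_+(1) − 2 n_+(2) = 1 + √3/2 − 4√5/5 > 0` (numerically `+0.0772`). -/
theorem dimer_evenodd_concavity :
    0 < dimerBondOcc3 1 (2 + Real.sqrt 3) (2 + Real.sqrt 3) 1 + 1
      - 2 * dimerBondOcc2 (Real.sqrt 2) (1 + Real.sqrt 5) (Real.sqrt 2) := by
  rw [dimer2_bondOcc, dimer3_bondOcc]
  have h3 := sqrt3_gt
  have h5 := sqrt5_lt
  linarith

end Summit.AtomisticToContinuum.BoseEinsteinCondensation.Theorems
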